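import Mathlib.MeasureTheory.Constructions.BorelSpace.Order
import Mathlib.Topology.MetricSpace.Thickening
import Mathlib.Analysis.Normed.Order.Lattice
import HarnessLib

/-!
# The coarse-grained sets `U_n` of BD18 §3.4: cell geometry

Topic `Literature/Analysis/Fourier`. In the proof of Theorem 4 of J. Bourgain, S. Dyatlov,
*Spectral gaps without the pressure condition*, Ann. of Math. 187 (2018), §3.4, the set `X` is
coarse-grained at scale `w = L^{-n}` by
`U_n = ⋃ {I(w/10) : I = [kw, (k+1)w] a grid cell meeting X}` ((3.20) there). This file proves the
three geometric facts about `U_n` used by the iteration (all elementary, no definitions; the set is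
written out as `⋃ k (_ : (X ∩ [kw,(k+1)w]) ≠ ∅), [kw - w/10, (k+1)w + w/10]`):

* `cellUnion_subset_Icc`, `measurableSet_cellUnion` — `U_n ⊂ [-3, 3]` is measurable (for
  `X ⊂ [-1,1]`, `w ≤ 1`);
* `Icc_subset_cellUnion` — `[x - w/10, x + w/10] ⊂ U_n` for `x ∈ X` (proof of BD18 Lemma 3.4);
* `disjoint_Icc_cellUnion` — if the cell `[k₀w, (k₀+1)w]` misses `X` and `x` lies in its middle
  half, then `[x - w/8, x + w/8] ∩ U_n = ∅` (BD18 (3.27): `L^{-n}I' ∩ U_{n+1}(L^{-n-T}/10) = ∅`);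
* `add_mem_cthickening` — `a + b ∈ Y(r + ρ)` for `|a| ≤ ρ`, `b ∈ Y(r)` (Fourier supports of
  products, BD18 proof of Lemma 3.5).
-/

namespace Literature.Analysis.Fourier

open Set

variable {X : Set ℝ} {w : ℝ}

/-- `U_n ⊂ [-3, 3]` when `X ⊂ [-1, 1]` and `w ≤ 1`. [cite: BourgainDyatlov2018, §3.4 (3.20)] -/
theorem cellUnion_subset_Icc (hX : X ⊆ Icc (-1) 1) (hw1 : w ≤ 1) :
    (⋃ (k : ℤ) (_ : (X ∩ Icc ((k : ℝ) * w) (((k : ℝ) + 1) * w)).Nonempty),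
        Icc ((k : ℝ) * w - w / 10) (((k : ℝ) + 1) * w + w / 10)) ⊆ Icc (-3) 3 := by
  intro y hy
  obtain ⟨k, ⟨x, hxX, hxc⟩, hyk⟩ := mem_iUnion₂.1 hy
  have hx := hX hxX
  simp only [mem_Icc] at hx hxc hyk ⊢
  constructor <;> nlinarith

/-- `U_n` is Borel measurable. [cite: BourgainDyatlov2018, §3.4 (3.20)] -/
theorem measurableSet_cellUnion :
    MeasurableSet (⋃ (k : ℤ) (_ : (X ∩ Icc ((k : ℝ) * w) (((k : ℝ) + 1) * w)).Nonempty),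
        Icc ((k : ℝ) * w - w / 10) (((k : ℝ) + 1) * w + w / 10)) :=
  MeasurableSet.iUnion fun _ => MeasurableSet.iUnion fun _ => measurableSet_Icc

/-- **`U_n` contains a `w/10`-neighbourhood of `X`** (proof of BD18 Lemma 3.4: for `x ∈ X`,
`[x - w/10, x + w/10] ⊂ U_n`). [cite: BourgainDyatlov2018, Lemma 3.4] -/
theorem Icc_subset_cellUnion (hw : 0 < w) {x : ℝ} (hx : x ∈ X) :
    Icc (x - w / 10) (x + w / 10) ⊆
      ⋃ (k : ℤ) (_ : (X ∩ Icc ((k : ℝ) * w) (((k : ℝ) + 1) * w)).Nonempty),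
        Icc ((k : ℝ) * w - w / 10) (((k : ℝ) + 1) * w + w / 10) := by
  intro y hy
  set k : ℤ := ⌊x / w⌋ with hk
  have hk1 : (k : ℝ) ≤ x / w := Int.floor_le _
  have hk2 : x / w < (k : ℝ) + 1 := Int.lt_floor_add_one _
  rw [le_div_iff₀ hw] at hk1
  rw [div_lt_iff₀ hw] at hk2
  refine mem_iUnion₂.2 ⟨k, ⟨x, hx, ?_⟩, ?_⟩
  · exact ⟨hk1, hk2.le⟩
  · simp only [mem_Icc] at hy ⊢
    constructor <;> linarith

/-- **Middle halves of `X`-free cells stay away from `U_n`** (BD18 (3.27)): if the grid cell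
`[k₀w, (k₀+1)w]` does not meet `X` and `|x - (k₀ + 1/2)w| ≤ w/4`, then `[x - w/8, x + w/8]` is
disjoint from `U_n` (neighbouring fattened cells penetrate the empty cell only to depth `w/10`).
[cite: BourgainDyatlov2018, §3.4 (3.27)] -/
theorem disjoint_Icc_cellUnion (hw : 0 < w) {k₀ : ℤ}
    (hk₀ : Disjoint X (Icc ((k₀ : ℝ) * w) (((k₀ : ℝ) + 1) * w))) {x : ℝ}
    (hx : |x - ((k₀ : ℝ) + 2⁻¹) * w| ≤ w / 4) :
    Disjoint (Icc (x - w / 8) (x + w / 8))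
      (⋃ (k : ℤ) (_ : (X ∩ Icc ((k : ℝ) * w) (((k : ℝ) + 1) * w)).Nonempty),
        Icc ((k : ℝ) * w - w / 10) (((k : ℝ) + 1) * w + w / 10)) := by
  rw [Set.disjoint_left]
  intro y hy hyU
  obtain ⟨k, hk, hyk⟩ := mem_iUnion₂.1 hyU
  have hne : k ≠ k₀ := by
    rintro rfl
    obtain ⟨z, hzX, hzc⟩ := hk
    exact Set.disjoint_left.1 hk₀ hzX hzc
  rw [abs_le] at hx
  simp only [mem_Icc] at hy hyk
  rcases lt_or_gt_of_ne hne with hlt | hlt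
  · have h1 : (k : ℝ) + 1 ≤ k₀ := by exact_mod_cast hlt
    nlinarith
  · have h1 : (k₀ : ℝ) + 1 ≤ k := by exact_mod_cast hlt
    nlinarith

/-- Sums land in a larger neighbourhood: if `|a| ≤ ρ` and `b ∈ Y(r)` (`Metric.cthickening r Y`,
`r ≥ 0`) then `a + b ∈ Y(r + ρ)`. [folklore] -/
theorem add_mem_cthickening {Y : Set ℝ} {r ρ a b : ℝ} (hr : 0 ≤ r) (ha : |a| ≤ ρ)
    (hb : b ∈ Metric.cthickening r Y) : a + b ∈ Metric.cthickening (r + ρ) Y := by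
  rw [Metric.mem_cthickening_iff] at hb ⊢
  have hρ : 0 ≤ ρ := (abs_nonneg a).trans ha
  have hab : edist (a + b) b ≤ ENNReal.ofReal ρ := by
    rw [edist_dist, Real.dist_eq, show a + b - b = a by ring]
    exact ENNReal.ofReal_le_ofReal ha
  calc Metric.infEDist (a + b) Y ≤ Metric.infEDist b Y + edist (a + b) b :=
        Metric.infEDist_le_infEDist_add_edist
    _ ≤ ENNReal.ofReal r + ENNReal.ofReal ρ := add_le_add hb hab
    _ = ENNReal.ofReal (r + ρ) := (ENNReal.ofReal_add hr hρ).symm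

end Literature.Analysis.Fourier
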